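import Literature.NumberTheory.Transcendental.QuadraticRelationsLogarithmsSec5Data
import Literature.NumberTheory.Transcendental.LinGroup
import Mathlib.Analysis.SpecialFunctions.Complex.LogBounds
import HarnessLib

/-!
# Roy–Waldschmidt 1997, §5: the perturbed points `η̃` and the coordinates of the box `Σ`

D. Roy, M. Waldschmidt, *Approximation diophantienne et indépendance algébrique de logarithmes*,
Ann. Sci. ÉNS (4) 30 (1997) 753–796, proof of Théorème 5.1, p. 782: "On utilise ensuite la
détermination principale du logarithme pour définir des éléments `η̃₁, …, η̃_N` de `T_G(ℂ)` tels
que `exp_G(η̃_j) = γ̃_j` et `|η̃_j − η_j| ≤ 2|γ̃_j − γ_j| / |γ_j|`" (where `γ̃_j = r(γ_j)` is the image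
of `γ_j = exp_G(η_j)` under the reduction map of the place, and the points of `Σ` are the
`γ₁^{s₁} ⋯ γ_{ℓ₁}^{s_{ℓ₁}}`).

PROVED here (pure complex analysis and bookkeeping; no definitions, no named facts):

* `exists_exp_eq_norm_le` — for `γ ≠ 0` and `|γ' − γ| ≤ |γ|/2` there is `z` with `e^z = γ'/γ`
  and `|z| ≤ (3/2)|γ' − γ|/|γ|` (principal logarithm, Mathlib's `‖log(1+u)‖ ≤ (3/2)‖u‖`);
* `exists_tilde` — given `η ∈ T_G(ℂ) = ℂ^{d₀} × ℂ^{d₁}`, additive data `ã` and multiplicative data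
  `g̃` with `|η⁽⁰⁾ᵢ − ãᵢ| ≤ δ`, `|e^{ηᵢ} − g̃ᵢ| ≤ δ|e^{ηᵢ}|`, `δ ≤ 1/2`, a point `η̃` with `η̃⁽⁰⁾ = ã`,
  `e^{η̃ᵢ} = g̃ᵢ` and `‖η − η̃‖ ≤ (3/2)δ`;
* the coordinates of the box points `η_s = ∑ₘ sₘ ηₘ` (`boxFamily`): `fst_boxFamily`
  (`(η_s)⁽⁰⁾ᵢ = ∑ₘ sₘ (ηₘ)⁽⁰⁾ᵢ`), `exp_snd_boxFamily` (`e^{(η_s)ᵢ} = ∏ₘ (e^{(ηₘ)ᵢ})^{sₘ}`),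
  `coord_exp_boxFamily_inl/inr` (coordinates of `exp_G(η_s)`), and the perturbation estimate
  `norm_boxFamily_sub_le` (`‖η_s − η̃_s‖ ≤ (∑ₘ Sₘ) · maxₘ ‖ηₘ − η̃ₘ‖`).

## References

* [RoyWaldschmidt1997ENS] D. Roy, M. Waldschmidt, Ann. Sci. ÉNS (4) 30 (1997) 753–796, proof of
  Théorème 5.1, p. 782.
-/

noncomputable section

open Complex

namespace Literature.NumberTheory.Transcendental

namespace RoyWaldschmidt1997

/-! ### The principal logarithm of a small perturbation -/

/-- For `γ ≠ 0` and `|γ' − γ| ≤ |γ|/2` there is `z ∈ ℂ` with `e^z = γ'/γ` and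
`|z| ≤ (3/2) |γ' − γ| / |γ|`. [cite: RoyWaldschmidt1997ENS, proof of Théorème 5.1, p. 782] -/
theorem exists_exp_eq_norm_le {γ γ' : ℂ} (hγ : γ ≠ 0) (h : ‖γ' - γ‖ ≤ ‖γ‖ / 2) :
    ∃ z : ℂ, exp z = γ' / γ ∧ ‖z‖ ≤ 3 / 2 * (‖γ' - γ‖ / ‖γ‖) := by
  have hγn : 0 < ‖γ‖ := norm_pos_iff.mpr hγ
  set u : ℂ := (γ' - γ) / γ with hu
  have hun : ‖u‖ = ‖γ' - γ‖ / ‖γ‖ := by rw [hu, norm_div]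
  have hu2 : ‖u‖ ≤ 1 / 2 := by
    rw [hun, div_le_iff₀ hγn]; linarith
  have h1u : 1 + u = γ' / γ := by
    rw [hu]; field_simp; ring
  have hne : 1 + u ≠ 0 := by
    intro h0
    have : ‖u‖ = 1 := by
      have : u = -1 := by linear_combination h0
      rw [this, norm_neg, norm_one]
    linarith
  refine ⟨log (1 + u), by rw [exp_log hne, h1u], ?_⟩
  rw [← hun]
  exact norm_log_one_add_half_le_self hu2

/-- **The points `η̃`.** Given `η ∈ ℂ^{d₀} × ℂ^{d₁}`, a vector `ã` with `|η⁽⁰⁾ᵢ − ãᵢ| ≤ δ` and a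
vector `g̃` with `|e^{ηᵢ} − g̃ᵢ| ≤ δ |e^{ηᵢ}|` (`0 ≤ δ ≤ 1/2`), there is `η̃` with `η̃⁽⁰⁾ = ã`,
`e^{η̃ᵢ} = g̃ᵢ` for all `i`, and `‖η − η̃‖ ≤ (3/2) δ`. [cite: RoyWaldschmidt1997ENS, proof of Théorème 5.1, p. 782] -/
theorem exists_tilde {d₀ d₁ : ℕ} (η : (Fin d₀ → ℂ) × (Fin d₁ → ℂ)) (at' : Fin d₀ → ℂ)
    (gt : Fin d₁ → ℂ) {δ : ℝ} (hδ : 0 ≤ δ) (hδ2 : δ ≤ 1 / 2)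
    (h1 : ∀ i, ‖η.1 i - at' i‖ ≤ δ) (h2 : ∀ i, ‖gt i - exp (η.2 i)‖ ≤ δ * ‖exp (η.2 i)‖) :
    ∃ ηt : (Fin d₀ → ℂ) × (Fin d₁ → ℂ), ηt.1 = at' ∧ (∀ i, exp (ηt.2 i) = gt i) ∧
      ‖η - ηt‖ ≤ 3 / 2 * δ := by
  have hz : ∀ i, ∃ z : ℂ, exp z = gt i / exp (η.2 i) ∧ ‖z‖ ≤ 3 / 2 * δ := by
    intro i
    have hγ : exp (η.2 i) ≠ 0 := exp_ne_zero _
    have hγn : 0 < ‖exp (η.2 i)‖ := norm_pos_iff.mpr hγ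
    have hh : ‖gt i - exp (η.2 i)‖ ≤ ‖exp (η.2 i)‖ / 2 := by
      refine (h2 i).trans ?_
      rw [le_div_iff₀ (by norm_num : (0 : ℝ) < 2)]
      nlinarith
    obtain ⟨z, hz1, hz2⟩ := exists_exp_eq_norm_le hγ hh
    refine ⟨z, hz1, hz2.trans ?_⟩
    have : ‖gt i - exp (η.2 i)‖ / ‖exp (η.2 i)‖ ≤ δ := by
      rw [div_le_iff₀ hγn]; exact h2 i
    linarith
  choose z hz1 hz2 using hz
  refine ⟨(at', fun i => η.2 i + z i), rfl, fun i => ?_, ?_⟩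
  · show exp (η.2 i + z i) = gt i
    rw [exp_add, hz1 i, mul_div_cancel₀ _ (exp_ne_zero _)]
  · rw [Prod.norm_def, max_le_iff]
    constructor
    · show ‖η.1 - at'‖ ≤ 3 / 2 * δ
      refine (pi_norm_le_iff_of_nonneg (by positivity)).mpr fun i => ?_
      rw [Pi.sub_apply]
      exact (h1 i).trans (by linarith)
    · show ‖η.2 - fun i => η.2 i + z i‖ ≤ 3 / 2 * δ
      refine (pi_norm_le_iff_of_nonneg (by positivity)).mpr fun i => ?_
      rw [Pi.sub_apply, show η.2 i - (η.2 i + z i) = -z i by ring, norm_neg]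
      exact hz2 i

/-! ### Coordinates of the points of the box `Σ` -/

section box

variable {ι : Type*} [Fintype ι] {d₀ d₁ : ℕ}

/-- Additive coordinates of a box point: `(η_s)⁽⁰⁾ᵢ = ∑ₘ sₘ (ηₘ)⁽⁰⁾ᵢ`. [folklore] -/
theorem fst_boxFamily (η : ι → (Fin d₀ → ℂ) × (Fin d₁ → ℂ)) (S : ι → ℕ) (s : ∀ m, Fin (S m + 1))
    (i : Fin d₀) : (boxFamily η S s).1 i = ∑ m, ((s m : ℕ) : ℂ) * (η m).1 i := by
  rw [boxFamily_apply, Prod.fst_sum, Finset.sum_apply]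
  refine Finset.sum_congr rfl fun m _ => ?_
  rw [Prod.smul_fst, Pi.smul_apply, zsmul_eq_mul]
  push_cast; ring

/-- Multiplicative (Lie) coordinates of a box point: `(η_s)ᵢ = ∑ₘ sₘ (ηₘ)ᵢ`. [folklore] -/
theorem snd_boxFamily (η : ι → (Fin d₀ → ℂ) × (Fin d₁ → ℂ)) (S : ι → ℕ) (s : ∀ m, Fin (S m + 1))
    (i : Fin d₁) : (boxFamily η S s).2 i = ∑ m, ((s m : ℕ) : ℂ) * (η m).2 i := by
  rw [boxFamily_apply, Prod.snd_sum, Finset.sum_apply]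
  refine Finset.sum_congr rfl fun m _ => ?_
  rw [Prod.smul_snd, Pi.smul_apply, zsmul_eq_mul]
  push_cast; ring

/-- `e^{(η_s)ᵢ} = ∏ₘ (e^{(ηₘ)ᵢ})^{sₘ}`. [folklore] -/
theorem exp_snd_boxFamily (η : ι → (Fin d₀ → ℂ) × (Fin d₁ → ℂ)) (S : ι → ℕ) (s : ∀ m, Fin (S m + 1))
    (i : Fin d₁) : exp ((boxFamily η S s).2 i) = ∏ m, exp ((η m).2 i) ^ (s m : ℕ) := by
  rw [snd_boxFamily, exp_sum]
  refine Finset.prod_congr rfl fun m _ => ?_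
  rw [← exp_nat_mul]

/-- Additive coordinates of `exp_G(η_s)`. [folklore] -/
theorem toAdd_exp_boxFamily_fst (η : ι → (Fin d₀ → ℂ) × (Fin d₁ → ℂ)) (S : ι → ℕ) (s : ∀ m, Fin (S m + 1))
    (i : Fin d₀) : Multiplicative.toAdd (LinGroup.exp (boxFamily η S s)).1 i = ∑ m, ((s m : ℕ) : ℂ) * (η m).1 i := by
  rw [LinGroup.toAdd_exp_fst, fst_boxFamily]

/-- Multiplicative coordinates of `exp_G(η_s)`. [folklore] -/
theorem coe_exp_boxFamily_snd (η : ι → (Fin d₀ → ℂ) × (Fin d₁ → ℂ)) (S : ι → ℕ) (s : ∀ m, Fin (S m + 1))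
    (i : Fin d₁) : ((LinGroup.exp (boxFamily η S s)).2 i : ℂ) = ∏ m, exp ((η m).2 i) ^ (s m : ℕ) := by
  rw [LinGroup.coe_exp_snd, exp_snd_boxFamily]

/-- **Perturbation of the box**: `‖η_s − η̃_s‖ ≤ (∑ₘ Sₘ) · C` if `‖ηₘ − η̃ₘ‖ ≤ C` for all `m`.
[cite: RoyWaldschmidt1997ENS, proof of Théorème 5.1, p. 782] -/
theorem norm_boxFamily_sub_le (η ηt : ι → (Fin d₀ → ℂ) × (Fin d₁ → ℂ)) (S : ι → ℕ)
    (s : ∀ m, Fin (S m + 1)) {C : ℝ} (h : ∀ m, ‖η m - ηt m‖ ≤ C) :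
    ‖boxFamily η S s - boxFamily ηt S s‖ ≤ (∑ m, (S m : ℝ)) * C := by
  rw [boxFamily_apply, boxFamily_apply, ← Finset.sum_sub_distrib, Finset.sum_mul]
  refine (norm_sum_le _ _).trans (Finset.sum_le_sum fun m _ => ?_)
  rw [← zsmul_sub, natCast_zsmul, ← Nat.cast_smul_eq_nsmul ℝ, norm_smul, Real.norm_natCast]
  have hs : ((s m : ℕ) : ℝ) ≤ S m := by
    have := (s m).is_lt
    exact_mod_cast Nat.lt_succ_iff.mp this
  exact mul_le_mul hs (h m) (norm_nonneg _) (Nat.cast_nonneg _)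

/-- The zero index of the box gives the point `0` (so `exp_G(η̃_0) = e`). [folklore] -/
theorem exp_boxFamily_zero (η : ι → (Fin d₀ → ℂ) × (Fin d₁ → ℂ)) (S : ι → ℕ) :
    LinGroup.exp (boxFamily η S (fun _ => 0)) = 1 := by
  rw [boxFamily_zero, LinGroup.exp_zero]

end box

end RoyWaldschmidt1997

end Literature.NumberTheory.Transcendental
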